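import Literature.AlgebraicGeometry.Resolution.HenselianConjugates
import Literature.AlgebraicGeometry.Resolution.HenselizedRationalDensity
import Mathlib.Algebra.CharP.Lemmas
import HarnessLib

/-!
# Krasner radius = distance to the ground field over deeply ramified fields (Temkin 2013, §3.1, Lemma 3.1.6)

Topic: `Literature/AlgebraicGeometry/Resolution` (valued function fields). M. Temkin,
*Inseparable local uniformization*, J. Algebra 373 (2013) 65–119 = arXiv:0804.1554, §3.1
"Discs over perfect analytic fields" (numbers of the earlier arXiv version held in the literature
store, as in the companion files), the valuation-theoretic input of the analytic uniformization of terminal points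
(Thms. 3.2.3, 3.2.4, 3.2.6) behind Thm. 3.3.1 — the named fact
`Temkin2013RelativeCurveSmoothFibre` (`InseparableLocalUniformizationCurvesStepOne.lean`), the
last deep input of `Temkin2013` (`InseparableLocalUniformizationHeightStepTrustBase.lean`):

> **Lemma 3.1.6.** Assume that `k` is deeply ramified, and let `l = k(α)` be a wildly ramified
> Galois extension of degree `p` with a conjugate `α₂ ≠ α` of `α`. Then
> `|α − α₂| = inf_{c ∈ k} |α − c|`.

("Recall that a valued field `k` is called deeply ramified if `k° = (k°)^p + p k°` … an
equicharacteristic valued field `k` is deeply ramified if and only if it is perfect", p. 21 of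
the held text.) The printed proof (p. 21): `r = |α − αᵢ| ≤ s` by Krasner's lemma in the form of
Lemma 3.1.3 (ii); if `r < s`, translate `α` by `c ∈ k` so that `t = |α|` is close to `s`, let
`a = N(α) = ∏ (α − (α − αᵢ))` be the norm, expand: `|a − α^p| ≤ r t^{p-1}`, i.e.
`|a^{1/p} − α| < t (r/t)^{1/p}`; since `k` is perfect `a^{1/p} ∈ k` approximates `α` better than
`s` — absurd.

This file PROVES the lemma in the EQUAL CHARACTERISTIC case, in the ambient rendering of the
tree (one algebraically closed valued field `(Ω, V)` of characteristic `p`, a subfield `E ≤ Ω`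
henselian for `V ∩ E`, `IsHenselianField`, `Henselization.lean`; "deeply ramified" = perfect =
every element of `E` is a `p`-th power in `E`; "height one" = `IsRankOneValued`), for any `α`
whose minimal polynomial over `E` has degree `p` — the printed hypothesis "Galois, wildly
ramified" enters the printed proof only through `[l : k] = p` (the norm is a product of `p`
factors) and is dropped; "complete" is weakened to "henselian" (only the invariance of `|·|`
under conjugation is used). The infimum is rendered without real numbers: the Krasner radius
`ρ = maxᵢ |α − αᵢ|` satisfies `ρ ≤ |α − c|` for every `c ∈ E`, and for every value `|g| > ρ`
of an element algebraic over `E` some `c ∈ E` has `|α − c| < |g|`.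

## Content (everything PROVED; no definitions, no named facts)

* `valuation_sub_le_of_mem_aroots_minpoly` — **Krasner's lemma for discs, Lemma 3.1.3 (ii) ⇒
  `r ≤ s`**: over a henselian `E`, `|α − β| ≤ |α − c|` for every `E`-conjugate `β` of `α` and
  every `c ∈ E` [folklore].
* `valuation_multiset_prod_sub_pow_le` — the expansion estimate `|∏ᵢ (x − βᵢ) − xⁿ| ≤ r |x|^{n-1}`
  for `|βᵢ| ≤ r ≤ |x|` [folklore].
* `exists_mem_valuation_sub_pow_le` — **the norm trick, one step** (proof of Lemma 3.1.6): `E`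
  perfect of characteristic `p`, `deg minpoly_E(α) = p`, `|α − β| ≤ ρ ≤ |α − c|` for the conjugates
  `β` and some `c ∈ E` ⇒ some `c' ∈ E` has `|α − c'|^p ≤ ρ |α − c|^{p-1}` (`c' = c + N(α − c)^{1/p}`).
* `krasnerRadius_eq_dist_of_perfect`, `exists_conj_krasnerRadius_eq_dist_of_perfect` —
  **Lemma 3.1.6 (equal characteristic)**: `E` henselian, perfect, of rank one and
  characteristic `p`, `deg minpoly_E(α) = p`, `β₀` a conjugate of `α` at maximal distance (it
  exists): `|α − β₀| ≤ |α − c|` for all `c ∈ E`, and for every `g` algebraic over `E` with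
  `|g| > |α − β₀|` some `c ∈ E` has `|α − c| < |g|`.

## Reading notes (not formalized here): the sources behind `Temkin2013RelativeCurveSmoothFibre`

Recorded because the printed proof of Thm. 3.3.1 is usually summarized as "Berkovich geometry and
the stable modification theorem", whereas its printed inputs are statements about (complete)
valued fields of rank one, of which this file proves the first:

1. The external input of Thm. 3.2.3 ("our starting point is [temst]") is M. Temkin, *Stable
   modification of relative curves*, J. Algebraic Geom. 19 (2010) = arXiv:0707.3953, **§6,
   Thm. 6.3.1 (i) under Assumption 6.2.1 (ii)**: `k` deeply ramified with `k = k^{mr}`, `K` a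
   one-dimensional analytic `k`-field of type 4 which is `k`-split ⇒ `K = \overline{k(z)}`. Its
   proof (§§6.1–6.3: cosets `S_{a,s}(K) = {c^p − ac + d}`, Prop. 6.1.4, orthogonal Schauder
   bases, Prop. 6.2.4, Lemma 6.2.9) is a computation in complete rank-one fields and in the
   Gauss-normed polynomial algebras of discs; the stable modification theorem is deduced from it
   in that paper, not conversely. The architecture — degree-`p` steps of `L/\overline{k(z)}`
   through normal forms of Artin–Schreier type generators — is that of F.-V. Kuhlmann,
   *Elimination of ramification II*, Israel J. Math. 234 (2019), §§4–5, proved in the tree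
   (`Kuhlmann2019_Prop52_sepClosed_holds`, `Kuhlmann2019Lemma42NormalForm.lean`,
   `Kuhlmann2019DegreePStepAssembly.lean`, `KuhlmannVlahuThm111.lean`), with "`K` separably
   closed" there versus "`k = k^{mr}` and `K` `k`-split" here (the `k`-split hypothesis disposes
   of the case of a constant in the special coset, end of the proof of Thm. 6.3.1).
2. Temkin 2013, §3.1: Lemma 3.1.6 (this file), Prop. 3.1.7 (the same equality for every
   `α ∈ k^a`, by a tower of unramified / tame prime degree / wild degree `p` steps), Cor. 3.1.10
   (`k` deeply ramified: `K` is `k`-split iff `k` is algebraically closed in `K`),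
   Cor. 3.1.8–3.1.9 (almost split discs).
3. Thm. 3.2.3: Step 2 (`L` = completion of `K ∩ k^a`; `K` is `L`-split by Cor. 3.1.10), Step 1
   (split case: base change to the tame hull `L^{mr}` only, 1., descent through a finite tame
   Galois level by [Duc] — cf. Kuhlmann 2019, Thm. 1.3, whose hypothesis "separable-algebraically
   maximal" is however not available for `L` —, then to a `k`-finite `l ⊆ L`); Thm. 3.2.4 (type 1
   via Ax–Sen, Remark 3.1.11); Thm. 3.2.6, Step 2 (completed perfection, and descent to a finite
   purely inseparable `k'/k` by density).
4. §3.3: algebraization of the resulting statement about `(k'K₁)^` (Thm. 2.7.2 (ii) in the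
   source; the Hensel-root-form mechanism of Knaf–Kuhlmann 2009, Lemma 3.7 —
   `KnafKuhlmann2009HenselianRationalityEtale.lean` — is the algebraic tool of the same kind).
Read in henselizations (in rank one the henselization is the separable-algebraic part of the
completion, `KrasnerHenselian.lean`), 1.–3. assert: for a rank-one valued field `k` of
characteristic `p` and a transcendentally immediate function field `F|k` of transcendence degree
one there are a finite purely inseparable `l/k`, a finite separable `m/l` inside `(lF)^h` and
`t ∈ lF·m` with `lF·m ⊆ m(t)^h`.

## Sources

* M. Temkin, *Inseparable local uniformization*, J. Algebra 373 (2013) 65–119 = arXiv:0804.1554: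
  §3.1, Lemma 3.1.3, Lemma 3.1.6, Prop. 3.1.7, Cor. 3.1.10 (pp. 20–22 of the held arXiv text);
  Thm. 3.2.3, Thm. 3.2.4, Thm. 3.2.6 (pp. 24–26); §3.3. [Temkin2013]
* M. Temkin, *Stable modification of relative curves*, J. Algebraic Geom. 19 (2010) 603–677 =
  arXiv:0707.3953: §6.1–6.3, Assumption 6.2.1, Thm. 6.3.1 (pp. 29–38 of the arXiv text).
* F.-V. Kuhlmann, *Elimination of ramification II: Henselian rationality*, Israel J. Math. 234
  (2019) 927–958 = arXiv:1701.05508: Thms. 1.3, 1.5, Prop. 5.2. [Kuhlmann2019]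

## Rendering notes

* Values are written multiplicatively (`V.valuation`, larger = farther from `0`), as `|·|` in the
  source. "`inf_{c ∈ k} |α − c| = ρ`" is the conjunction of `ρ ≤ |α − c|` (`c ∈ E`) and
  "`|α − c| < |g|` for some `c ∈ E`" for every `g` algebraic over `E` with `ρ < |g|`; values of
  elements algebraic over `E` are the meaningful thresholds (they are cofinal around `ρ` in the
  divisible hull of `|E^×|`, `IsRankOneValued.archimedean_of_isAlgebraic`), arbitrary elements
  of the value group of the ambient `Ω` are not (the valuation of `Ω` may have higher rank).
-/

noncomputable section

open Polynomial

namespace Literature.AlgebraicGeometry.Resolution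

universe u

/-! ### The expansion estimate -/

section Estimate

variable {R : Type u} [CommRing R] {Γ₀ : Type*} [LinearOrderedCommGroupWithZero Γ₀]
  (v : Valuation R Γ₀)

/-- **Expansion estimate**: if `|βᵢ| ≤ r ≤ |x|` for the elements `βᵢ` of a multiset `s` of
cardinality `n`, then `|∏ᵢ (x − βᵢ) − xⁿ| ≤ r·|x|^{n-1}` (every other term of the expansion
contains a factor `βᵢ`). [folklore] -/
theorem valuation_multiset_prod_sub_pow_le (x : R) (r : Γ₀) (hrx : r ≤ v x) :
    ∀ s : Multiset R, (∀ β ∈ s, v β ≤ r) →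
      v ((s.map fun β => x - β).prod - x ^ Multiset.card s) ≤
        r * v x ^ (Multiset.card s - 1) := by
  intro s
  induction s using Multiset.induction_on with
  | empty =>
    intro _
    simp
  | cons β s ih =>
    intro hs
    have hβ : v β ≤ r := hs β (Multiset.mem_cons_self β s)
    have hs' : ∀ γ ∈ s, v γ ≤ r := fun γ hγ => hs γ (Multiset.mem_cons_of_mem hγ)
    rw [Multiset.map_cons, Multiset.prod_cons, Multiset.card_cons, Nat.add_sub_cancel]
    -- `(x - β) P - x^{n+1} = (x - β)(P - x^n) - β x^n`
    have hid : (x - β) * (s.map fun β => x - β).prod - x ^ (Multiset.card s + 1) =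
        (x - β) * ((s.map fun β => x - β).prod - x ^ Multiset.card s) -
          β * x ^ Multiset.card s := by ring
    rw [hid]
    have hxβ : v (x - β) ≤ v x :=
      le_trans (Valuation.map_sub v x β) (max_le le_rfl (le_trans hβ hrx))
    refine le_trans (Valuation.map_sub v _ _) (max_le ?_ ?_)
    · -- the first summand
      rw [Valuation.map_mul]
      rcases Nat.eq_zero_or_eq_succ_pred (Multiset.card s) with h0 | hsucc
      · -- `s = 0`: `P - x^0 = 0`
        have hs0 : s = 0 := Multiset.card_eq_zero.mp h0
        subst hs0
        simp
      · have ih' := ih hs'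
        rw [hsucc, Nat.succ_sub_one] at ih'
        rw [hsucc]
        calc v (x - β) * v ((s.map fun β => x - β).prod - x ^ (Multiset.card s).pred.succ)
            ≤ v x * (r * v x ^ (Multiset.card s).pred) := mul_le_mul' hxβ ih'
          _ = r * v x ^ (Multiset.card s).pred.succ := by
              rw [mul_left_comm, pow_succ, mul_comm (v x) (v x ^ _)]
    · -- the second summand `β x^n`
      rw [Valuation.map_mul, Valuation.map_pow]
      exact mul_le_mul_left hβ _

end Estimate

/-! ### Over a subfield of an algebraically closed valued field of characteristic `p` -/

section Ambient

variable {Ω : Type u} [Field Ω] [IsAlgClosed Ω] (V : ValuationSubring Ω)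

/-- **Krasner's lemma for discs (Temkin 2013, Lemma 3.1.3 (ii)), in the form `r ≤ s` of the
proof of Lemma 3.1.6**: over a henselian subfield `E`, every `E`-conjugate `β` of an algebraic
`α` (root of its minimal polynomial) satisfies `|α − β| ≤ |α − c|` for every `c ∈ E` — since
`|β − c| = |α − c|` (conjugation preserves values over a henselian field). PROVED.
[cite: Temkin2013, Lemma 3.1.3 (ii)] -/
theorem valuation_sub_le_of_mem_aroots_minpoly {E : Subfield Ω}
    (hE : IsHenselianField E (V.comap (algebraMap E Ω))) {α : Ω} (hα : IsIntegral E α)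
    {β : Ω} (hβ : β ∈ (minpoly E α).aroots Ω) {c : Ω} (hc : c ∈ E) :
    V.valuation (α - β) ≤ V.valuation (α - c) := by
  have hconj : IsConjRoot E α β := (isConjRoot_iff_mem_minpoly_aroots hα).mpr hβ
  have key := hE.valuation_aeval_eq_of_isConjRoot_of_subfield V hα.isAlgebraic hconj
    (X - C (⟨c, hc⟩ : E))
  have hαc : aeval α (X - C (⟨c, hc⟩ : E)) = α - c := by simp; rfl
  have hβc : aeval β (X - C (⟨c, hc⟩ : E)) = β - c := by simp; rfl
  rw [hαc, hβc] at key
  have hid : α - β = (α - c) - (β - c) := by ring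
  rw [hid]
  refine le_trans (Valuation.map_sub _ _ _) (max_le le_rfl ?_)
  rw [← key]

/-- The minimal polynomial of an algebraic `α` over a subfield `E` of the algebraically closed
`Ω` is the product of `X − β` over its roots `β` in `Ω`, and it has `deg` many roots.
[folklore] -/
theorem aeval_minpoly_eq_prod_aroots {E : Subfield Ω} {α : Ω} (hα : IsIntegral E α) :
    (∀ x : Ω, aeval x (minpoly E α) = (((minpoly E α).aroots Ω).map fun β => x - β).prod) ∧
      Multiset.card ((minpoly E α).aroots Ω) = (minpoly E α).natDegree := by
  have hsplit : ((minpoly E α).map (algebraMap E Ω)).Splits := IsAlgClosed.splits _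
  have hmonic : (minpoly E α).Monic := minpoly.monic hα
  refine ⟨fun x => hsplit.aeval_eq_prod_aroots_of_monic hmonic x, ?_⟩
  rw [aroots, ← hsplit.natDegree_eq_card_roots, natDegree_map]

/-- **The norm trick of the proof of Temkin 2013, Lemma 3.1.6 — one step.** Let `Ω` have
characteristic `p`, `E ≤ Ω` a subfield in which every element is a `p`-th power (`E` perfect =
deeply ramified in equal characteristic), `α ∈ Ω` algebraic over `E` with minimal polynomial of
degree `p`, `ρ` a bound for the distances `|α − β|` to its conjugates, and `c ∈ E` with
`ρ ≤ |α − c|`. Then some `c' ∈ E` satisfies `|α − c'|^p ≤ ρ·|α − c|^{p-1}`: with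
`a = N(α − c) = ∏_β (β − c) ∈ E` one has `|a − (α − c)^p| ≤ ρ |α − c|^{p-1}`
(`valuation_multiset_prod_sub_pow_le`), and `c' = c + a^{1/p}` gives
`(α − c')^p = (α − c)^p − a`. PROVED. [cite: Temkin2013, Lemma 3.1.6 (proof)] -/
theorem exists_mem_valuation_sub_pow_le (p : ℕ) [hp : Fact p.Prime] [CharP Ω p]
    {E : Subfield Ω} (hperf : ∀ y ∈ E, ∃ b ∈ E, b ^ p = y) {α : Ω} (hα : IsIntegral E α)
    (hdeg : (minpoly E α).natDegree = p) {ρ : V.ValueGroup}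
    (hρ : ∀ β ∈ (minpoly E α).aroots Ω, V.valuation (α - β) ≤ ρ) {c : Ω} (hc : c ∈ E)
    (hρc : ρ ≤ V.valuation (α - c)) :
    ∃ c' ∈ E, V.valuation (α - c') ^ p ≤ ρ * V.valuation (α - c) ^ (p - 1) := by
  obtain ⟨hprod, hcard⟩ := aeval_minpoly_eq_prod_aroots hα
  set S := (minpoly E α).aroots Ω with hS
  -- the norm `a = ∏ (β - c)` and its membership in `E`
  set a : Ω := (S.map fun β => β - c).prod with ha
  have haE : a ∈ E := by
    -- `∏ (c - β) = minpoly(c) ∈ E`, and `a = (-1)^p ∏ (c - β)`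
    have h1 : aeval c (minpoly E α) = (S.map fun β => c - β).prod := hprod c
    have h2 : aeval c (minpoly E α) ∈ E := by
      have : aeval c (minpoly E α) = algebraMap E Ω (aeval (⟨c, hc⟩ : E) (minpoly E α)) := by
        rw [← aeval_algebraMap_apply]; rfl
      rw [this]; exact SetLike.coe_mem _
    have h3 : a = (S.map fun β => (-1 : Ω) * (c - β)).prod := by
      rw [ha]; congr 1; refine Multiset.map_congr rfl fun β _ => by ring
    rw [h3, Multiset.prod_map_mul, Multiset.map_const', Multiset.prod_replicate, ← h1]
    exact E.mul_mem (E.pow_mem (E.neg_mem E.one_mem) _) h2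
  obtain ⟨b, hbE, hb⟩ := hperf a haE
  refine ⟨c + b, E.add_mem hc hbE, ?_⟩
  -- `(α - (c + b))^p = (α - c)^p - a`
  have hfrob : (α - (c + b)) ^ p = (α - c) ^ p - a := by
    rw [show α - (c + b) = (α - c) - b by ring, sub_pow_char (α - c) b, hb]
  -- the expansion estimate for `x = α - c`, `βᵢ ↦ α - βᵢ`
  have hest := valuation_multiset_prod_sub_pow_le V.valuation (α - c) ρ hρc
    (S.map fun β => α - β) (by
      intro γ hγ
      obtain ⟨β, hβ, rfl⟩ := Multiset.mem_map.mp hγ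
      exact hρ β hβ)
  have hprod' : ((S.map fun β => α - β).map fun γ => (α - c) - γ).prod = a := by
    rw [ha, Multiset.map_map]; congr 1
    refine Multiset.map_congr rfl fun β _ => ?_
    simp only [Function.comp_apply]; ring
  rw [hprod', Multiset.card_map, hcard, hdeg] at hest
  rw [← Valuation.map_pow, hfrob, Valuation.map_sub_swap]
  exact hest

/-- **Temkin 2013, Lemma 3.1.6 (equal characteristic): over a deeply ramified field of height
one the Krasner radius of `α` is its distance to the field.** Let `Ω` be algebraically closed
of characteristic `p` with valuation ring `V`, `E ≤ Ω` a subfield which is henselian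
(`IsHenselianField`), perfect (every element a `p`-th power in `E`: "an equicharacteristic
valued field is deeply ramified if and only if it is perfect") and of rank one
(`IsRankOneValued`), `α ∈ Ω` algebraic over `E` with minimal polynomial of degree `p`, and `β₀` a
conjugate of `α` at maximal distance `ρ = |α − β₀| = max_β |α − β|` (the Krasner radius). Then
`ρ = inf_{c ∈ E} |α − c|`: every `c ∈ E` has `ρ ≤ |α − c|`, and for every `g` algebraic over `E`
with `|g| > ρ` some `c ∈ E` has `|α − c| < |g|`. In the printed case — `E(α)/E` Galois of degree
`p` — every conjugate `β₀ ≠ α` is at the same distance, so this is "`|α − α₂| = inf_{c∈k}|α − c|`";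
the hypotheses "complete" and "Galois, wildly ramified" of the source are weakened to
"henselian" and "`deg minpoly = p`", which is all the printed proof uses. PROVED: the one-step
improvement `|α − c'|^p ≤ ρ |α − c|^{p-1}` (`exists_mem_valuation_sub_pow_le`) is iterated —
`|α − c_n|^p ≤ (ρ/|g|)^n |α|^p` as long as `|α − c_n| ≥ |g|` — and the archimedean property of
rank one (`IsRankOneValued.archimedean_of_isAlgebraic`) ends the iteration.
[cite: Temkin2013, Lemma 3.1.6] -/
theorem krasnerRadius_eq_dist_of_perfect (p : ℕ) [hp : Fact p.Prime] [CharP Ω p]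
    {E : Subfield Ω} (hE : IsHenselianField E (V.comap (algebraMap E Ω)))
    (hperf : ∀ y ∈ E, ∃ b ∈ E, b ^ p = y) (hr1 : IsRankOneValued V E) {α : Ω}
    (hα : IsIntegral E α) (hdeg : (minpoly E α).natDegree = p) {β₀ : Ω}
    (hβ₀ : β₀ ∈ (minpoly E α).aroots Ω)
    (hmax : ∀ β ∈ (minpoly E α).aroots Ω, V.valuation (α - β) ≤ V.valuation (α - β₀)) :
    (∀ c ∈ E, V.valuation (α - β₀) ≤ V.valuation (α - c)) ∧
      ∀ g : Ω, IsAlgebraic E g → V.valuation (α - β₀) < V.valuation g →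
        ∃ c ∈ E, V.valuation (α - c) < V.valuation g := by
  classical
  set ρ := V.valuation (α - β₀) with hρ
  have hkras : ∀ c ∈ E, ρ ≤ V.valuation (α - c) := fun c hc =>
    valuation_sub_le_of_mem_aroots_minpoly V hE hα hβ₀ hc
  refine ⟨hkras, ?_⟩
  intro g hg hρg
  set γ := V.valuation g with hγ
  have hγ0 : 0 < γ := lt_of_le_of_lt zero_le hρg
  have hp1 : 1 ≤ p := hp.out.one_lt.le
  -- the decay ratio `q = ρ / γ < 1`
  set q := ρ / γ with hq
  have hq1 : q < 1 := by rw [hq, div_lt_one₀ hγ0]; exact hρg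
  -- iteration: after `n` steps, either done or `|α - c|^p ≤ q^n |α|^p`
  have hiter : ∀ n : ℕ, ∃ c ∈ E, V.valuation (α - c) < γ ∨
      V.valuation (α - c) ^ p ≤ q ^ n * V.valuation α ^ p := by
    intro n
    induction n with
    | zero => exact ⟨0, E.zero_mem, Or.inr (by rw [sub_zero, pow_zero, one_mul])⟩
    | succ n ih =>
      obtain ⟨c, hc, hlt | hle⟩ := ih
      · exact ⟨c, hc, Or.inl hlt⟩
      · by_cases hlt : V.valuation (α - c) < γ
        · exact ⟨c, hc, Or.inl hlt⟩
        · have hlt : γ ≤ V.valuation (α - c) := le_of_not_gt hlt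
          set t := V.valuation (α - c) with ht
          have ht0 : 0 < t := lt_of_lt_of_le hγ0 hlt
          obtain ⟨c', hc', hstep⟩ :=
            exists_mem_valuation_sub_pow_le V p hperf hα hdeg hmax hc (hkras c hc)
          refine ⟨c', hc', Or.inr (le_trans hstep ?_)⟩
          -- `ρ t^{p-1} = (ρ/t) t^p ≤ (ρ/γ) t^p ≤ q · q^n |α|^p`
          have h1 : ρ * t ^ (p - 1) = ρ / t * t ^ p := by
            rw [div_mul_eq_mul_div, eq_div_iff ht0.ne', mul_assoc, ← pow_succ,
              Nat.sub_add_cancel hp1]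
          rw [h1, pow_succ', mul_assoc]
          refine mul_le_mul' ?_ hle
          rw [hq, div_eq_mul_inv, div_eq_mul_inv]
          exact mul_le_mul_right (inv_anti₀ hγ0 hlt) ρ
  -- archimedean: `q^N |α|^p < γ^p` for some `N`
  have harch : ∃ N : ℕ, q ^ N * V.valuation α ^ p < γ ^ p := by
    have hγp : 0 < γ ^ p := pow_pos hγ0 p
    by_cases hρ0 : ρ = 0
    · refine ⟨1, ?_⟩
      rw [hq, hρ0, zero_div, pow_one, zero_mul]
      exact hγp
    · -- `ρ = |α - β₀| > 0`: use `y = g / (α - β₀)`, `|y| = γ/ρ > 1`, and `z = α^p / g^p`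
      have hρpos : 0 < ρ := zero_lt_iff.mpr hρ0
      have hβ₀int : IsIntegral E β₀ :=
        (IsConjRoot.isIntegral_iff ((isConjRoot_iff_mem_minpoly_aroots hα).mpr hβ₀)).mp hα
      have hyalg : IsAlgebraic E (g / (α - β₀)) := by
        rw [div_eq_mul_inv]
        exact (hg.isIntegral.mul (hα.sub hβ₀int).inv).isAlgebraic
      have hzalg : IsAlgebraic E (α ^ p / g ^ p) := by
        rw [div_eq_mul_inv]
        exact ((hα.pow p).mul (hg.isIntegral.pow p).inv).isAlgebraic
      have hy1 : 1 < V.valuation (g / (α - β₀)) := by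
        rw [map_div₀, ← hρ, ← hγ, one_lt_div₀ hρpos]
        exact hρg
      obtain ⟨n, hn⟩ := hr1.archimedean_of_isAlgebraic hyalg hzalg hy1
      rw [map_div₀, map_div₀, Valuation.map_pow, Valuation.map_pow, ← hρ, ← hγ, div_pow] at hn
      -- `|α|^p / γ^p ≤ (γ/ρ)^n`, i.e. `q^n |α|^p ≤ γ^p`
      have hqn : q ^ n * V.valuation α ^ p ≤ γ ^ p := by
        rw [div_le_iff₀ hγp] at hn
        have hρn : 0 < ρ ^ n := pow_pos hρpos n
        rw [hq, div_pow, div_mul_eq_mul_div, div_le_iff₀ (pow_pos hγ0 n)]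
        calc ρ ^ n * V.valuation α ^ p ≤ ρ ^ n * (γ ^ n / ρ ^ n * γ ^ p) :=
              mul_le_mul_right hn _
          _ = γ ^ p * γ ^ n := by
              rw [div_mul_eq_mul_div, mul_div_assoc', mul_comm (ρ ^ n), mul_div_assoc,
                div_self hρn.ne', mul_one, mul_comm]
      refine ⟨n + 1, ?_⟩
      calc q ^ (n + 1) * V.valuation α ^ p = q * (q ^ n * V.valuation α ^ p) := by
            rw [pow_succ', mul_assoc]
        _ ≤ q * γ ^ p := mul_le_mul_right hqn q
        _ < γ ^ p := mul_lt_of_lt_one_left hγp hq1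
  obtain ⟨N, hN⟩ := harch
  obtain ⟨c, hc, hlt | hle⟩ := hiter N
  · exact ⟨c, hc, hlt⟩
  · exact ⟨c, hc, lt_of_pow_lt_pow_left' p (lt_of_le_of_lt hle hN)⟩

/-- **Temkin 2013, Lemma 3.1.6 (equal characteristic), with the maximizing conjugate
produced**: under the same hypotheses there is a conjugate `β₀` of `α` (a root of its minimal
polynomial) with `|α − β| ≤ |α − β₀| ≤ |α − c|` for all conjugates `β` and all `c ∈ E`, and
`|α − β₀| = inf_{c ∈ E} |α − c|` in the sense of `krasnerRadius_eq_dist_of_perfect`. PROVED.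
[cite: Temkin2013, Lemma 3.1.6] -/
theorem exists_conj_krasnerRadius_eq_dist_of_perfect (p : ℕ) [hp : Fact p.Prime] [CharP Ω p]
    {E : Subfield Ω} (hE : IsHenselianField E (V.comap (algebraMap E Ω)))
    (hperf : ∀ y ∈ E, ∃ b ∈ E, b ^ p = y) (hr1 : IsRankOneValued V E) {α : Ω}
    (hα : IsIntegral E α) (hdeg : (minpoly E α).natDegree = p) :
    ∃ β₀ ∈ (minpoly E α).aroots Ω,
      (∀ β ∈ (minpoly E α).aroots Ω, V.valuation (α - β) ≤ V.valuation (α - β₀)) ∧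
      (∀ c ∈ E, V.valuation (α - β₀) ≤ V.valuation (α - c)) ∧
      ∀ g : Ω, IsAlgebraic E g → V.valuation (α - β₀) < V.valuation g →
        ∃ c ∈ E, V.valuation (α - c) < V.valuation g := by
  classical
  set S := (minpoly E α).aroots Ω with hS
  -- a conjugate realizing the maximum of `|α - β|` (the roots contain `α` itself)
  have hSne : S.toFinset.Nonempty := by
    refine ⟨α, Multiset.mem_toFinset.mpr ?_⟩
    rw [hS, mem_aroots]
    exact ⟨minpoly.ne_zero hα, minpoly.aeval E α⟩
  obtain ⟨β₀, hβ₀S, hβ₀max⟩ := S.toFinset.exists_max_image (fun β => V.valuation (α - β)) hSne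
  have hβ₀ : β₀ ∈ S := Multiset.mem_toFinset.mp hβ₀S
  have hmax : ∀ β ∈ S, V.valuation (α - β) ≤ V.valuation (α - β₀) := fun β hβ =>
    hβ₀max β (Multiset.mem_toFinset.mpr hβ)
  exact ⟨β₀, hβ₀, hmax, krasnerRadius_eq_dist_of_perfect V p hE hperf hr1 hα hdeg hβ₀ hmax⟩

end Ambient

end Literature.AlgebraicGeometry.Resolution
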